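/-
Copyright (c) 2026 The decomp-a2c cell. All rights reserved.
Released under Apache 2.0 license as described in the file LICENSE.
-/
import Summits.AtomisticToContinuum.Crystallization.Theorems.ChartedZeroExcessLayeredLatticeLiouvilleWL

/-!
# ChartedZeroExcessLayeredLatticeLiouville — part WM «HalfBall»: re-centred pointwise second-difference bounds on the HALF ball
  (decomp-a2c-lens-2, g58; helper of stmt-AtomisticToContinuum-26636, leaf (LD′) `ModalLipschitzZ`; brick (4a), step (WM) of the g58 plan,
  memo NODE-g58d §1–2)

`ModalLipschitzAt C ϱ n₁ a b w` (part VG) bounds `n²·#ball·‖(φ − M)(Y) − (φ − M)(X)‖²` by `C·(dist X x₀ + 1)²·E` for EVERY unit bond `X ~ Y`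
of the HALF ball `idxBall x₀ (n/2)`, `M` a `ϱ`-truncated mode.  Parts WA/WF/WK/WL give the pointwise second-difference bounds on the QUARTER ball;
this part moves them to the half ball by RE-CENTRING: for `Z ∈ idxBall x₀ (n/2)` the ball `idxBall Z (n/2)` lies inside `idxBall x₀ n`, and
`#idxBall x₀ n ≤ 27n³ = 216·(n/2)³ ≤ 216·#idxBall Z (n/2)`, so every constant picks up the factor `864 = 4·216` and the single threshold
becomes `512(ϱ/c+2) ≤ n`:

* `norm_hessian_halfBall`, `norm_gap_halfBall` — in-plane Hessian and gap gradient at every site of the half ball;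
* ★ `inPlane_bond_halfBall` — slope drift `n²N‖D_Eφ(X) − D_Eφ(x₀)‖² ≤ 864·ipConst·dist(X,x₀)²·E` for in-plane unit steps `E`;
* ★ `vertical_bond_inPlane_halfBall` — in-layer transport of the vertical increment to the central column,
  `n²N‖D₃φ(X) − D₃φ(x₀.1, X.2)‖² ≤ 3456·gradConst·dist(X,x₀)²·E`.
The conditional assembly of (4a) from these two bounds and the profile comparison on the central column is part WN.
-/

namespace Summit.AtomisticToContinuum.Crystallization.Theorems.ChartedZeroExcessLayeredLatticeLiouville

open Summit.AtomisticToContinuum.Crystallization.Theorems.ChartedPlanarOrderRigidityDoor (E3)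
open Finset
open scoped InnerProductSpace RealInnerProductSpace BigOperators

noncomputable section HalfBall

variable {c : ℝ} {a b : E3} {w : ℤ → E3}

/-! ### WM.1  Re-centring: pointwise second-difference bounds on the half ball -/

/-- `gradConst ≥ 0`. [formal bookkeeping] -/
theorem gradConst_nonneg (hc : 0 < c) {κ₀ : ℝ} (hκ₀ : 0 < κ₀) (ε : ℝ) : 0 ≤ gradConst c κ₀ ε := by
  have hF := kernelConst_nonneg hc
  have hlip : 0 < lipConst c κ₀ := zero_lt_one.trans_le (one_le_lipConst hc hκ₀)
  have hdC := divConst_nonneg hc hκ₀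
  unfold gradConst gradBrk
  positivity

/-- `ipConst ≥ 0`. [formal bookkeeping] -/
theorem ipConst_nonneg (hc : 0 < c) {κ₀ : ℝ} (hκ₀ : 0 < κ₀) (ε : ℝ) : 0 ≤ ipConst c κ₀ ε := by
  have hF := kernelConst_nonneg hc
  have hlip : 0 < lipConst c κ₀ := zero_lt_one.trans_le (one_le_lipConst hc hκ₀)
  have hgc := gradConst_nonneg hc hκ₀ ε
  unfold ipConst
  positivity

/-- the single threshold `512(ϱ/c+2) ≤ n` implies WK's cubic threshold at radius `n/2`. [formal bookkeeping] -/
theorem cube_threshold_half {ϱ c n : ℝ} (hϱc : 0 ≤ ϱ / c) (hn : 512 * (ϱ / c + 2) ≤ n) : 2 ^ 25 * (ϱ / c) ≤ (n / 2) ^ 3 := by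
  have h1 : 1024 ≤ n := by linarith
  have h2 : 512 * (ϱ / c) ≤ n := by linarith
  have h4 : (1024 * 1024) * (512 * (ϱ / c)) ≤ (n * n) * n :=
    mul_le_mul (mul_le_mul h1 h1 (by norm_num) (by linarith)) h2 (by positivity) (by positivity)
  have h3 : (n / 2) ^ 3 = n * n * n / 8 := by ring
  rw [h3, le_div_iff₀ (by norm_num : (0 : ℝ) < 8)]
  nlinarith

/-- `#(idxBall x₀ n) ≤ 216 · #(idxBall Z (n/2))` for `n ≥ 1` (`27n³ = 216(n/2)³`). [formal bookkeeping] -/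
theorem ncard_le_recentred (x₀ Z : Cell 2 × ℤ) {n : ℝ} (hn : 1 ≤ n) :
    ((idxBall x₀ n).ncard : ℝ) ≤ 216 * ((idxBall Z (n / 2)).ncard : ℝ) := by
  have h1 := ncard_idxBall_le_cube x₀ hn
  have h2 := cube_le_ncard_idxBall Z (show (0 : ℝ) ≤ n / 2 by linarith)
  nlinarith

/-- re-centred balls stay inside: `Z ∈ idxBall x₀ (n/2) ⟹ idxBall Z (n/2) ⊆ idxBall x₀ n`. [formal bookkeeping] -/
theorem idxBall_half_subset {x₀ Z : Cell 2 × ℤ} {n : ℝ} (hZ : Z ∈ idxBall x₀ (n / 2)) : idxBall Z (n / 2) ⊆ idxBall x₀ n :=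
  idxBall_subset_of_dist (by have h : dist Z x₀ ≤ n / 2 := hZ; linarith)

/-- the ratio bookkeeping of re-centring: `K·E_Z/((n/2)²·N_Z) ≤ 864·K·E/(n²·N)`. [formal bookkeeping] -/
theorem recentre_ratio_le {K EZ E NZ N n : ℝ} (hK : 0 ≤ K) (hEZ : 0 ≤ EZ) (hE : EZ ≤ E) (hNZ : 0 < NZ) (hN : N ≤ 216 * NZ)
    (hN0 : 0 < N) (hn : 0 < n) : K * EZ / ((n / 2) ^ 2 * NZ) ≤ 864 * K * E / (n ^ 2 * N) := by
  rw [div_le_div_iff₀ (by positivity) (by positivity)]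
  have h1 : K * EZ * N ≤ K * E * (216 * NZ) := mul_le_mul (mul_le_mul_of_nonneg_left hE hK) hN hN0.le (mul_nonneg hK (hEZ.trans hE))
  nlinarith [mul_le_mul_of_nonneg_left h1 (sq_nonneg n)]

/-- a squared bound with the factor `P = n²·N` in front gives a square-root bound. [formal bookkeeping] -/
theorem norm_le_sqrt_of_sq {v : E3} {P A : ℝ} (hP : 0 < P) (h : P * ‖v‖ ^ 2 ≤ A) : ‖v‖ ≤ Real.sqrt (A / P) := by
  have h2 : ‖v‖ ^ 2 ≤ A / P := by rw [le_div_iff₀ hP]; linarith [mul_comm P (‖v‖ ^ 2)]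
  have h3 := Real.abs_le_sqrt h2
  rwa [abs_norm] at h3

/-- IN-PLANE HESSIAN ON THE HALF BALL (re-centred WF `norm_hessian_le_sqrt`): for `φ` harmonic on `idxBall x₀ n`, `n ≥ 64(ϱ/c+2)` and
`Z ∈ idxBall x₀ (n/2)`, `‖D_E D_E' φ(Z)‖ ≤ √(864 · 6912·(54F/κ₀)·lipConst · E/(n²·N))`. [this file, g58] -/
theorem norm_hessian_halfBall (hc : 0 < c) {κ₀ ϱ : ℝ} (hκ₀ : 0 < κ₀) (hϱ : 0 ≤ ϱ)
    (hP : ∀ E₀ : Cell 2 × ℤ, E₀.2 = 0 → (idxNorm E₀ : ℝ) ≤ 1 → ∀ (y₀ : Cell 2 × ℤ) (r' n' : ℝ), r' < n' → ∀ χ : Cell 2 → ℤ → E3,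
      IsTruncHarmonicZ ϱ a b w χ (idxBall y₀ (n' + 1)) →
        κ₀ * idxEnergy (latDiff E₀ χ) (idxBall y₀ r') ≤ 54 * kernelConst c * ((n' - r')⁻¹) ^ 2 * idxEnergy χ (idxBall y₀ (n' + ϱ / c + 1)))
    (x₀ : Cell 2 × ℤ) {n : ℝ} (hn : 64 * (ϱ / c + 2) ≤ n) {φ : Cell 2 → ℤ → E3} (hφ : IsTruncHarmonicZ ϱ a b w φ (idxBall x₀ n))
    {E : Cell 2 × ℤ} (hE : E.2 = 0) (hE1 : (idxNorm E : ℝ) ≤ 1) {E' : Cell 2 × ℤ} (hE' : E'.2 = 0) (hE'1 : (idxNorm E' : ℝ) ≤ 1)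
    {Z : Cell 2 × ℤ} (hZ : Z ∈ idxBall x₀ (n / 2)) :
    ‖latDiff E (latDiff E' φ) Z.1 Z.2‖ ≤
      Real.sqrt (864 * (6912 * (54 * kernelConst c / κ₀) * lipConst c κ₀) * idxEnergy φ (idxBall x₀ n) / (n ^ 2 * (idxBall x₀ n).ncard)) := by
  have hϱc : 0 ≤ ϱ / c := div_nonneg hϱ hc.le
  have hn1 : 1 ≤ n := by linarith
  have hF := kernelConst_nonneg hc
  have hlip : 0 < lipConst c κ₀ := zero_lt_one.trans_le (one_le_lipConst hc hκ₀)
  have hφZ := isTruncHarmonicZ_mono hφ (idxBall_half_subset hZ)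
  have hZZ : Z ∈ idxBall Z (n / 2 / 4) := by
    show dist Z Z ≤ n / 2 / 4
    rw [dist_self]
    positivity
  have h := norm_hessian_le_sqrt hc hκ₀ hϱ hP Z (show 32 * (ϱ / c + 2) ≤ n / 2 by linarith) hφZ hE hE1 hE' hE'1 hZZ
  refine h.trans (Real.sqrt_le_sqrt ?_)
  have hEZ : idxEnergy φ (idxBall Z (n / 2)) ≤ idxEnergy φ (idxBall x₀ n) :=
    idxEnergy_le_of_dist φ (by have h' : dist Z x₀ ≤ n / 2 := hZ; linarith)
  exact recentre_ratio_le (by positivity) (idxEnergy_nonneg _ _) hEZ (ncard_idxBall_pos Z (by positivity)) (ncard_le_recentred x₀ Z hn1)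
    (ncard_idxBall_pos x₀ (by positivity)) (by positivity)

/-- MIXED HESSIAN ON THE HALF BALL (re-centred WK/WL `norm_gap_le_sqrt`): for `φ` harmonic on `idxBall x₀ n`, `n ≥ 512(ϱ/c+2)` and
`Z ∈ idxBall x₀ (n/2)`, `‖D₃ D_E φ(Z)‖ ≤ √(864 · gradConst · E/(n²·N))`. [this file, g58] -/
theorem norm_gap_halfBall (hc : 0 < c) (hL : IsLayeredCrystal c a b w) {κ₀ ε ϱ : ℝ} (hκ₀ : 0 < κ₀) (hϱ : 0 ≤ ϱ) (hε : ε < 2 * κ₀)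
    (hK : CoerciveZ (layeredKernel a b w) κ₀)
    (hT : ∀ φ : Cell 2 → ℤ → E3, HasFiniteSupport φ → Summable (tailFam ϱ a b w φ) ∧ ∑' x, tailFam ϱ a b w φ x ≤ ε * nnFormZ φ)
    (hP : ∀ E₀ : Cell 2 × ℤ, E₀.2 = 0 → (idxNorm E₀ : ℝ) ≤ 1 → ∀ (y₀ : Cell 2 × ℤ) (r' n' : ℝ), r' < n' → ∀ χ : Cell 2 → ℤ → E3,
      IsTruncHarmonicZ ϱ a b w χ (idxBall y₀ (n' + 1)) →
        κ₀ * idxEnergy (latDiff E₀ χ) (idxBall y₀ r') ≤ 54 * kernelConst c * ((n' - r')⁻¹) ^ 2 * idxEnergy χ (idxBall y₀ (n' + ϱ / c + 1)))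
    (x₀ : Cell 2 × ℤ) {n : ℝ} (hn : 512 * (ϱ / c + 2) ≤ n) {φ : Cell 2 → ℤ → E3} (hφ : IsTruncHarmonicZ ϱ a b w φ (idxBall x₀ n))
    {E : Cell 2 × ℤ} (hE : E.2 = 0) (hE1 : (idxNorm E : ℝ) ≤ 1) {Z : Cell 2 × ℤ} (hZ : Z ∈ idxBall x₀ (n / 2)) :
    ‖latDiff idxAxis₃ (latDiff E φ) Z.1 Z.2‖ ≤ Real.sqrt (864 * gradConst c κ₀ ε * idxEnergy φ (idxBall x₀ n) / (n ^ 2 * (idxBall x₀ n).ncard)) := by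
  have hϱc : 0 ≤ ϱ / c := div_nonneg hϱ hc.le
  have hn1 : 1 ≤ n := by linarith
  have hgc := gradConst_nonneg hc hκ₀ ε
  have hφZ := isTruncHarmonicZ_mono hφ (idxBall_half_subset hZ)
  have hZZ : Z ∈ idxBall Z (n / 2 / 2) := by
    show dist Z Z ≤ n / 2 / 2
    rw [dist_self]
    positivity
  have h := norm_gap_le_sqrt hc hL hκ₀ hϱ hε hK hT hP Z (show 256 * (ϱ / c + 2) ≤ n / 2 by linarith) (cube_threshold_half hϱc hn)
    hφZ hE hE1 hZZ
  refine h.trans (Real.sqrt_le_sqrt ?_)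
  have hEZ : idxEnergy φ (idxBall Z (n / 2)) ≤ idxEnergy φ (idxBall x₀ n) :=
    idxEnergy_le_of_dist φ (by have h' : dist Z x₀ ≤ n / 2 := hZ; linarith)
  exact recentre_ratio_le hgc (idxEnergy_nonneg _ _) hEZ (ncard_idxBall_pos Z (by positivity)) (ncard_le_recentred x₀ Z hn1)
    (ncard_idxBall_pos x₀ (by positivity)) (by positivity)

/-- ★ SLOPE DRIFT ON THE HALF BALL (WL `inPlane_bond_sq_le`, re-centred): for `φ` harmonic on `idxBall x₀ n`, `n ≥ 512(ϱ/c+2)`, an in-plane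
unit step `E` and `X ∈ idxBall x₀ (n/2)`: `n²·N·‖D_E φ(X) − D_E φ(x₀)‖² ≤ 864·ipConst·dist(X,x₀)²·E`. [this file, g58] -/
theorem inPlane_bond_halfBall (hc : 0 < c) (hL : IsLayeredCrystal c a b w) {κ₀ ε ϱ : ℝ} (hκ₀ : 0 < κ₀) (hϱ : 0 ≤ ϱ) (hε : ε < 2 * κ₀)
    (hK : CoerciveZ (layeredKernel a b w) κ₀)
    (hT : ∀ φ : Cell 2 → ℤ → E3, HasFiniteSupport φ → Summable (tailFam ϱ a b w φ) ∧ ∑' x, tailFam ϱ a b w φ x ≤ ε * nnFormZ φ)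
    (hP : ∀ E₀ : Cell 2 × ℤ, E₀.2 = 0 → (idxNorm E₀ : ℝ) ≤ 1 → ∀ (y₀ : Cell 2 × ℤ) (r' n' : ℝ), r' < n' → ∀ χ : Cell 2 → ℤ → E3,
      IsTruncHarmonicZ ϱ a b w χ (idxBall y₀ (n' + 1)) →
        κ₀ * idxEnergy (latDiff E₀ χ) (idxBall y₀ r') ≤ 54 * kernelConst c * ((n' - r')⁻¹) ^ 2 * idxEnergy χ (idxBall y₀ (n' + ϱ / c + 1)))
    (x₀ : Cell 2 × ℤ) {n : ℝ} (hn : 512 * (ϱ / c + 2) ≤ n) {φ : Cell 2 → ℤ → E3} (hφ : IsTruncHarmonicZ ϱ a b w φ (idxBall x₀ n))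
    {E : Cell 2 × ℤ} (hE : E.2 = 0) (hE1 : (idxNorm E : ℝ) ≤ 1) {X : Cell 2 × ℤ} (hX : X ∈ idxBall x₀ (n / 2)) :
    n ^ 2 * ((idxBall x₀ n).ncard : ℝ) * ‖latDiff E φ X.1 X.2 - latDiff E φ x₀.1 x₀.2‖ ^ 2 ≤
      864 * ipConst c κ₀ ε * dist X x₀ ^ 2 * idxEnergy φ (idxBall x₀ n) := by
  have hϱc : 0 ≤ ϱ / c := div_nonneg hϱ hc.le
  have hn0 : 0 < n := by linarith
  have hn64 : 64 * (ϱ / c + 2) ≤ n := by linarith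
  have hN := ncard_idxBall_pos x₀ hn0.le
  have hF := kernelConst_nonneg hc
  have hlip : 0 < lipConst c κ₀ := zero_lt_one.trans_le (one_le_lipConst hc hκ₀)
  have hgc := gradConst_nonneg hc hκ₀ ε
  have hE0 := idxEnergy_nonneg φ (idxBall x₀ n)
  set H : ℝ := 864 * (6912 * (54 * kernelConst c / κ₀) * lipConst c κ₀) * idxEnergy φ (idxBall x₀ n) / (n ^ 2 * (idxBall x₀ n).ncard)
    with hHdef
  set G : ℝ := 864 * gradConst c κ₀ ε * idxEnergy φ (idxBall x₀ n) / (n ^ 2 * (idxBall x₀ n).ncard) with hGdef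
  have hH0 : 0 ≤ H := by positivity
  have hG0 : 0 ≤ G := by positivity
  have hXF : X ∈ idxBallF x₀ (n / 2) := by rw [← mem_coe, coe_idxBallF]; exact hX
  have mem : ∀ Z ∈ idxBallF x₀ (n / 2), Z ∈ idxBall x₀ (n / 2) := fun Z hZ => by rw [← mem_coe, coe_idxBallF] at hZ; exact hZ
  have h₁ : ∀ Z ∈ idxBallF x₀ (n / 2), Z + idxAxis₁ ∈ idxBallF x₀ (n / 2) → ‖latDiff idxAxis₁ (latDiff E φ) Z.1 Z.2‖ ≤ Real.sqrt H :=
    fun Z hZ _ => norm_hessian_halfBall hc hκ₀ hϱ hP x₀ hn64 hφ idxAxis₁_snd idxNorm_idxAxis₁_le hE hE1 (mem Z hZ)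
  have h₂ : ∀ Z ∈ idxBallF x₀ (n / 2), Z + idxAxis₂ ∈ idxBallF x₀ (n / 2) → ‖latDiff idxAxis₂ (latDiff E φ) Z.1 Z.2‖ ≤ Real.sqrt H :=
    fun Z hZ _ => norm_hessian_halfBall hc hκ₀ hϱ hP x₀ hn64 hφ idxAxis₂_snd idxNorm_idxAxis₂_le hE hE1 (mem Z hZ)
  have h₃ : ∀ Z ∈ idxBallF x₀ (n / 2), Z + idxAxis₃ ∈ idxBallF x₀ (n / 2) → Z.1 = x₀.1 →
      ‖latDiff idxAxis₃ (latDiff E φ) Z.1 Z.2‖ ≤ Real.sqrt G :=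
    fun Z hZ _ _ => norm_gap_halfBall hc hL hκ₀ hϱ hε hK hT hP x₀ hn hφ hE hE1 (mem Z hZ)
  have hw := corner_walk_idxNorm (latDiff E φ) x₀ (by positivity : (0 : ℝ) ≤ n / 2) (Real.sqrt_nonneg H) (Real.sqrt_nonneg H)
    (Real.sqrt_nonneg G) h₁ h₂ h₃ hXF
  have hd : (idxNorm (X - x₀) : ℝ) = dist X x₀ := by rw [dist_comm, dist_eq_idxNorm]
  rw [hd] at hw
  have hsq : ‖latDiff E φ X.1 X.2 - latDiff E φ x₀.1 x₀.2‖ ^ 2 ≤ (dist X x₀ * (Real.sqrt H + Real.sqrt H + Real.sqrt G)) ^ 2 :=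
    pow_le_pow_left₀ (norm_nonneg _) hw 2
  have e3 : (Real.sqrt H + Real.sqrt H + Real.sqrt G) ^ 2 ≤ 8 * H + 2 * G := by
    have e₁ := Real.sq_sqrt hH0
    have e₂ := Real.sq_sqrt hG0
    nlinarith [sq_nonneg (2 * Real.sqrt H - Real.sqrt G), Real.sqrt_nonneg H, Real.sqrt_nonneg G]
  have e4 : n ^ 2 * ((idxBall x₀ n).ncard : ℝ) * (8 * H + 2 * G) = 864 * ipConst c κ₀ ε * idxEnergy φ (idxBall x₀ n) := by
    rw [hHdef, hGdef, ipConst]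
    field_simp
  calc n ^ 2 * ((idxBall x₀ n).ncard : ℝ) * ‖latDiff E φ X.1 X.2 - latDiff E φ x₀.1 x₀.2‖ ^ 2
      ≤ n ^ 2 * ((idxBall x₀ n).ncard : ℝ) * (dist X x₀ * (Real.sqrt H + Real.sqrt H + Real.sqrt G)) ^ 2 :=
        mul_le_mul_of_nonneg_left hsq (by positivity)
    _ = dist X x₀ ^ 2 * (n ^ 2 * ((idxBall x₀ n).ncard : ℝ) * (Real.sqrt H + Real.sqrt H + Real.sqrt G) ^ 2) := by ring
    _ ≤ dist X x₀ ^ 2 * (n ^ 2 * ((idxBall x₀ n).ncard : ℝ) * (8 * H + 2 * G)) :=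
        mul_le_mul_of_nonneg_left (mul_le_mul_of_nonneg_left e3 (by positivity)) (sq_nonneg _)
    _ = 864 * ipConst c κ₀ ε * dist X x₀ ^ 2 * idxEnergy φ (idxBall x₀ n) := by rw [e4]; ring

/-- ★ VERTICAL INCREMENT VS CENTRAL COLUMN ON THE HALF BALL (WL `vertical_bond_inPlane_sq_le`, re-centred): for `X ∈ idxBall x₀ (n/2)`,
`n²·N·‖D₃φ(X) − D₃φ(x₀.1, X.2)‖² ≤ 3456·gradConst·dist(X,x₀)²·E`. [this file, g58] -/
theorem vertical_bond_inPlane_halfBall (hc : 0 < c) (hL : IsLayeredCrystal c a b w) {κ₀ ε ϱ : ℝ} (hκ₀ : 0 < κ₀) (hϱ : 0 ≤ ϱ)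
    (hε : ε < 2 * κ₀) (hK : CoerciveZ (layeredKernel a b w) κ₀)
    (hT : ∀ φ : Cell 2 → ℤ → E3, HasFiniteSupport φ → Summable (tailFam ϱ a b w φ) ∧ ∑' x, tailFam ϱ a b w φ x ≤ ε * nnFormZ φ)
    (hP : ∀ E₀ : Cell 2 × ℤ, E₀.2 = 0 → (idxNorm E₀ : ℝ) ≤ 1 → ∀ (y₀ : Cell 2 × ℤ) (r' n' : ℝ), r' < n' → ∀ χ : Cell 2 → ℤ → E3,
      IsTruncHarmonicZ ϱ a b w χ (idxBall y₀ (n' + 1)) →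
        κ₀ * idxEnergy (latDiff E₀ χ) (idxBall y₀ r') ≤ 54 * kernelConst c * ((n' - r')⁻¹) ^ 2 * idxEnergy χ (idxBall y₀ (n' + ϱ / c + 1)))
    (x₀ : Cell 2 × ℤ) {n : ℝ} (hn : 512 * (ϱ / c + 2) ≤ n) {φ : Cell 2 → ℤ → E3} (hφ : IsTruncHarmonicZ ϱ a b w φ (idxBall x₀ n))
    {X : Cell 2 × ℤ} (hX : X ∈ idxBall x₀ (n / 2)) :
    n ^ 2 * ((idxBall x₀ n).ncard : ℝ) * ‖latDiff idxAxis₃ φ X.1 X.2 - latDiff idxAxis₃ φ x₀.1 X.2‖ ^ 2 ≤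
      3456 * gradConst c κ₀ ε * dist X x₀ ^ 2 * idxEnergy φ (idxBall x₀ n) := by
  have hϱc : 0 ≤ ϱ / c := div_nonneg hϱ hc.le
  have hn0 : 0 < n := by linarith
  have hN := ncard_idxBall_pos x₀ hn0.le
  have hgc := gradConst_nonneg hc hκ₀ ε
  have hE0 := idxEnergy_nonneg φ (idxBall x₀ n)
  set G : ℝ := 864 * gradConst c κ₀ ε * idxEnergy φ (idxBall x₀ n) / (n ^ 2 * (idxBall x₀ n).ncard) with hGdef
  have hG0 : 0 ≤ G := by positivity
  have hXF : X ∈ idxBallF x₀ (n / 2) := by rw [← mem_coe, coe_idxBallF]; exact hX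
  have mem : ∀ Z ∈ idxBallF x₀ (n / 2), Z ∈ idxBall x₀ (n / 2) := fun Z hZ => by rw [← mem_coe, coe_idxBallF] at hZ; exact hZ
  have h₁ : ∀ Z ∈ idxBallF x₀ (n / 2), Z + idxAxis₁ ∈ idxBallF x₀ (n / 2) → ‖latDiff idxAxis₁ (latDiff idxAxis₃ φ) Z.1 Z.2‖ ≤ Real.sqrt G :=
    fun Z hZ _ => by
      rw [latDiff_latDiff_comm]
      exact norm_gap_halfBall hc hL hκ₀ hϱ hε hK hT hP x₀ hn hφ idxAxis₁_snd idxNorm_idxAxis₁_le (mem Z hZ)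
  have h₂ : ∀ Z ∈ idxBallF x₀ (n / 2), Z + idxAxis₂ ∈ idxBallF x₀ (n / 2) → ‖latDiff idxAxis₂ (latDiff idxAxis₃ φ) Z.1 Z.2‖ ≤ Real.sqrt G :=
    fun Z hZ _ => by
      rw [latDiff_latDiff_comm]
      exact norm_gap_halfBall hc hL hκ₀ hϱ hε hK hT hP x₀ hn hφ idxAxis₂_snd idxNorm_idxAxis₂_le (mem Z hZ)
  have hd : (idxNorm (X - x₀) : ℝ) = dist X x₀ := by rw [dist_comm, dist_eq_idxNorm]
  have hYn : (idxNorm ((x₀.1, X.2) - x₀) : ℝ) ≤ idxNorm (X - x₀) := by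
    rw [show (x₀.1, X.2) - x₀ = (x₀.1 - x₀.1, X.2 - x₀.2) from rfl]
    exact_mod_cast idxNorm_mk_le (by simp) (by simp) (natAbs_snd_le_idxNorm (X - x₀))
  have hYF : (x₀.1, X.2) ∈ idxBallF x₀ (n / 2) := by
    rw [mem_idxBallF_iff_idxNorm]
    have h4 : dist X x₀ ≤ n / 2 := hX
    linarith
  have hw := inPlane_walk (latDiff idxAxis₃ φ) x₀ (by positivity : (0 : ℝ) ≤ n / 2) h₁ h₂ hXF hYF rfl
  have a0 : ((((X.1 - x₀.1) 0).natAbs : ℕ) : ℝ) ≤ idxNorm (X - x₀) := by exact_mod_cast natAbs_fst_le_idxNorm (X - x₀) 0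
  have a1 : ((((X.1 - x₀.1) 1).natAbs : ℕ) : ℝ) ≤ idxNorm (X - x₀) := by exact_mod_cast natAbs_fst_le_idxNorm (X - x₀) 1
  rw [hd] at a0 a1
  have hG' := Real.sqrt_nonneg G
  have hw' : ‖latDiff idxAxis₃ φ X.1 X.2 - latDiff idxAxis₃ φ x₀.1 X.2‖ ≤ 2 * dist X x₀ * Real.sqrt G := by
    have b0 := mul_le_mul_of_nonneg_right a0 hG'
    have b1 := mul_le_mul_of_nonneg_right a1 hG'
    have hw2 : ‖latDiff idxAxis₃ φ X.1 X.2 - latDiff idxAxis₃ φ (x₀.1, X.2).1 (x₀.1, X.2).2‖ ≤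
        ((((X.1 - (x₀.1, X.2).1) 0).natAbs : ℕ) : ℝ) * Real.sqrt G + ((((X.1 - (x₀.1, X.2).1) 1).natAbs : ℕ) : ℝ) * Real.sqrt G := hw
    dsimp only at hw2
    linarith
  have hsq : ‖latDiff idxAxis₃ φ X.1 X.2 - latDiff idxAxis₃ φ x₀.1 X.2‖ ^ 2 ≤ (2 * dist X x₀ * Real.sqrt G) ^ 2 :=
    pow_le_pow_left₀ (norm_nonneg _) hw' 2
  have e3 : (2 * dist X x₀ * Real.sqrt G) ^ 2 = 4 * dist X x₀ ^ 2 * G := by rw [mul_pow, mul_pow, Real.sq_sqrt hG0]; ring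
  have e4 : n ^ 2 * ((idxBall x₀ n).ncard : ℝ) * G = 864 * gradConst c κ₀ ε * idxEnergy φ (idxBall x₀ n) := by
    rw [hGdef]
    field_simp
  calc n ^ 2 * ((idxBall x₀ n).ncard : ℝ) * ‖latDiff idxAxis₃ φ X.1 X.2 - latDiff idxAxis₃ φ x₀.1 X.2‖ ^ 2
      ≤ n ^ 2 * ((idxBall x₀ n).ncard : ℝ) * (4 * dist X x₀ ^ 2 * G) := by
        rw [← e3]; exact mul_le_mul_of_nonneg_left hsq (by positivity)
    _ = 4 * dist X x₀ ^ 2 * (n ^ 2 * ((idxBall x₀ n).ncard : ℝ) * G) := by ring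
    _ = 3456 * gradConst c κ₀ ε * dist X x₀ ^ 2 * idxEnergy φ (idxBall x₀ n) := by rw [e4]; ring

/-! ### WM.2  The closed statement of this part -/

/-- The content of part WM as one closed proposition: the slope drift of a harmonic field on the HALF ball, with the single threshold
`512(ϱ/c+2) ≤ n`. -/
def HalfBallShape : Prop :=
  ∀ c : ℝ, 0 < c → ∀ (a b : E3) (w : ℤ → E3), IsLayeredCrystal c a b w → ∀ κ₀ ε ϱ : ℝ, 0 < κ₀ → 0 ≤ ϱ → ε < 2 * κ₀ →
    CoerciveZ (layeredKernel a b w) κ₀ →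
    (∀ φ : Cell 2 → ℤ → E3, HasFiniteSupport φ → Summable (tailFam ϱ a b w φ) ∧ ∑' x, tailFam ϱ a b w φ x ≤ ε * nnFormZ φ) →
    (∀ E₀ : Cell 2 × ℤ, E₀.2 = 0 → (idxNorm E₀ : ℝ) ≤ 1 → ∀ (y₀ : Cell 2 × ℤ) (r' n' : ℝ), r' < n' → ∀ χ : Cell 2 → ℤ → E3,
      IsTruncHarmonicZ ϱ a b w χ (idxBall y₀ (n' + 1)) →
        κ₀ * idxEnergy (latDiff E₀ χ) (idxBall y₀ r') ≤ 54 * kernelConst c * ((n' - r')⁻¹) ^ 2 * idxEnergy χ (idxBall y₀ (n' + ϱ / c + 1))) →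
    ∀ (x₀ : Cell 2 × ℤ) (n : ℝ), 512 * (ϱ / c + 2) ≤ n → ∀ φ : Cell 2 → ℤ → E3,
      IsTruncHarmonicZ ϱ a b w φ (idxBall x₀ n) → ∀ E : Cell 2 × ℤ, E.2 = 0 → (idxNorm E : ℝ) ≤ 1 → ∀ X : Cell 2 × ℤ, X ∈ idxBall x₀ (n / 2) →
        n ^ 2 * ((idxBall x₀ n).ncard : ℝ) * ‖latDiff E φ X.1 X.2 - latDiff E φ x₀.1 x₀.2‖ ^ 2 ≤
          864 * ipConst c κ₀ ε * dist X x₀ ^ 2 * idxEnergy φ (idxBall x₀ n)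

/-- WM holds. [this file, g58] -/
theorem halfBallShape_holds : HalfBallShape :=
  fun _c hc _a _b _w hL _κ₀ _ε _ϱ hκ₀ hϱ hε hK hT hP x₀ _n hn _φ hφ _E hE hE1 _X hX =>
    inPlane_bond_halfBall hc hL hκ₀ hϱ hε hK hT hP x₀ hn hφ hE hE1 hX

end HalfBall

end Summit.AtomisticToContinuum.Crystallization.Theorems.ChartedZeroExcessLayeredLatticeLiouville
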